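import Summits.QuantumFields.BalabanUV.T4Continuum.Support.TermwiseLocal

/-!
# TermwiseLocalBinders — the one-level binders (bch), (sz), (osc-U) of the term-wise `U(N)` chain under LOCAL
hypotheses on the window box `Δ(p′_y)`: the locality of Bałaban's one-step average threaded through the packaged data
`ψ_U`, `Φ_U`, `φ_U` of `T4TermwiseUN`

Cell `pub-balaban`, rung (B)+1 sub-cell t4, lineage `b2b-balaban-t4-ne7-p1` (node U5 = NE7, TERM-WISE member;
generation 17), record `t4/T4-EST-NE7-P1.md` §22; companion of `Support/TermwiseLocal`.  HONEST FRAMING (page 1):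
FIXED FINITE T⁴, rung (B)+1, conditional on BetaPertH and the nine spine estimates (0/9 proved); NOT infinite volume,
NOT a mass gap, NOT the Clay problem; NE7 NOT PRINTED in [Balaban1984PropagatorsI]–[Balaban1989LargeFieldII], NOT
proved here.  [folklore] bookkeeping over the tree's `B7Prop1Local` (the clamped extension `clampCfg` and the
congruences `cplaq_bavg_congr`, `hol_treeWord_congr`), `T4TermwiseTorus` (`tker`, `textend`, `zpos`), `T4TermwiseUN`
(`phiM`, `GM`, `phiU`, `psiU`, `PhiU`) and `T4TermwiseChainUN` (the GLOBAL one-level lemmas); no sentence of print is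
used as a fact; nothing printed is asserted; constants unchanged.

THE POINT (record (21b)).  Generation 13's one-level lemmas for `U(N)` Wilson terms assume (44) `|V(∂p) − 1| ≤ α₀`
and (44∇) for ALL plaquettes/bonds of `ℤ^d`.  For a history whose background is regular only LEVEL BY LEVEL the
level-graded ledger (`Support/TermwiseLevelsLedger`) needs them with the constant of the WINDOW's level, from
hypotheses near the window only.  Print's locality (B7 p. 24–25: `V̄(∂p′)` depends on `V_b`, `b ⊂ Δ(p′)`) is exactly
what is needed, and the tree already holds its kernel form (`B7Prop1Local`).  METHOD: (bch) — the clamped extension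
`π^*V` of `V|Δ(p′_y)` satisfies (44) on all of `ℤ^d` with the box's `α₀` (`norm_hol_plaqWord_clampCfg_le`), the global
lemma `bch_PhiU_four` applies to it, and `ψ_U(y)`, `Σ_x pker(y,x)•Φ_U(y,x)` are the same for `V` and `π^*V` (§3: the
window positions, their plaquettes, the far corner and the axial tree contours all lie in `Δ(p′_y)`); (sz) — one
plaquette, or by `T`-periodicity the window position congruent to it; (osc-U) — NOT by clamping (the clamped
extension oscillates by `O(α₀)` across the box boundary) but by the local telescoping `TermwiseLocal.conjOsc_treeWord`
along the two tree contours from the far corner, which stay in `Δ(p′_y)`.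

WHAT IS PROVED ([folklore]).
§3 LOCALITY OF THE PACKAGED DATA under `AgreeOn` on the window box: `hol_plaqWord_congr`, `phiM_congr`,
   `axialFn_congr`, `GM_congr`, `psiU_congr`, `PhiU_congr_of_tker` (at fine labels of non-zero weight — the torus
   extension picks a window position), `bchSum_congr`.
§4 THE LOCAL ONE-LEVEL BINDERS: **`bch_PhiU_local`** — `T4TermwiseChainUN.bch_PhiU_four` (`d = 4`,
   `20480·L²·α₀ ≤ 1`, `T ≥ 2L`) with (44) assumed ONLY for `p ⊂ Δ(p′_y)`: `‖ψ_U(y) − Σ_x pker(y,x)•Φ_U(y,x)‖ ≤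
   280(320L²α₀)²`; **`norm_phiU_le_local`** (`‖φ_U(x)‖ ≤ 2α₀` from (44) at that plaquette, `α₀ ≤ ½`);
   **`norm_phiU_le_window_local`** (the window-wise form for `T`-periodic `V`: `0 < pker(y,x)` and (44) on `Δ(p′_y)`);
   **`norm_PhiU_sub_PhiU_local`** — `T4TermwiseChainUN.norm_PhiU_sub_PhiU` (`‖Φ_U(y,x) − Φ_U(y,x′)‖ ≤ 4dL·α₁` on the
   kernel's support) with the one-bond covariant oscillation `α₁` of `log V(∂p)` assumed ONLY on the bonds of `Δ(p′_y)`.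

BINDER STATUS.  These are LEMMAS about the cell's concrete one-step objects; their hypotheses — (44) and (44∇) on
`Δ(p′_y)` with a constant depending on the window — are what `Support/TermwiseLocalLedger` asks of the two runs'
backgrounds window by window (ESTIMATES there, located in shape at [Balaban1985Variational] conditions (2) p. 278 per
domain `Ω_j`; NOT PRINTED for two runs).  NOT DELIVERED: per-window (44)/(44∇) from per-window `LocReg`/`HolderReg`
(generation 14's `binders_of_locReg` is already local in its INPUT — a ball around each site — but states its OUTPUT
uniformly; re-keying it per window is the next, small, step); anything about print.  Value = the per-window
localisation of the `U(N)` one-level binders, kernel-checked; NOT NE7, NOT summit progress.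

References (LOCATIONS only): [Balaban1985Averaging] Commun. Math. Phys. 98 (1985) 17–51, (20) p. 21, (26) p. 22, (42)
p. 23, pp. 24–25 (locality), (46)–(51) pp. 25–26; [Balaban1985Variational] Commun. Math. Phys. 102 (1985) 277–309,
conditions (2) p. 278.
-/

noncomputable section

open scoped BigOperators Matrix.Norms.L2Operator
open Finset

namespace Summit.QuantumFields.BalabanUV.T4Continuum.TermwiseLocal

open Literature.MathematicalPhysics.QuantumFieldTheory.Balaban1983to89
open B7Prop1Explicit B7Prop2Explicit B7Prop1Local T4TermwiseBCH T4TermwiseTorus T4TermwiseUN T4TermwiseChainUN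
open T4TermwiseOscillation (norm_conj_sub_conj farCorner l1_zpos_sub_farCorner_le)

/-! ## §3 Locality of the packaged `U(N)` data of `T4TermwiseUN` (`phiM`, `GM`, `psiU`, `PhiU`, the (bch) sum) -/

section Congr

variable {n : Type*} [Fintype n] [DecidableEq n] {d : ℕ} {lo hi : Site d}
  {V V' : Site d → Fin d → (Matrix n n ℂ)ˣ}

/-- The plaquette variable of a plaquette inside the box is determined by the bonds of the box. [folklore] -/
theorem hol_plaqWord_congr (h : AgreeOn lo hi V V') {x : Site d} {κ ν : Fin d} (hp : PlaqIn lo hi (x, κ, ν)) :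
    hol V x (plaqWord κ ν) = hol V' x (plaqWord κ ν) := by
  obtain ⟨h0, hκ, hν, h2⟩ := inBox_corners_of_plaqIn hp
  have h2' : InBox lo hi (x + e ν + e κ) := by rw [add_right_comm]; exact h2
  rw [hol_plaqWord_eq, hol_plaqWord_eq, h x κ h0 hκ, h (x + e κ) ν hκ h2, h (x + e ν) κ hν h2', h x ν h0 hν]

/-- `phiM` of a plaquette inside the box is determined by the bonds of the box. [folklore] -/
theorem phiM_congr (h : AgreeOn lo hi V V') {P : Fin d × Fin d} {x : Site d} (hp : PlaqIn lo hi (x, P.1, P.2)) :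
    phiM V P x = phiM V' P x := by
  unfold phiM; rw [hol_plaqWord_congr h hp]

/-- The axial gauge function `axialFn V c x = V(Γ_{c,x})` is determined by the bonds of a box containing `c` and `x`.
[folklore] -/
theorem axialFn_congr (h : AgreeOn lo hi V V') {c x : Site d} (hc : InBox lo hi c) (hx : InBox lo hi x) :
    axialFn V c x = axialFn V' c x := by
  unfold axialFn
  exact hol_treeWord_congr h c (x - c) hc (by rw [add_sub_cancel]; exact hx)

/-- The transported window field `GM L V y x′` at a point `x′` whose plaquette lies in the window box is determined by
the bonds of the window box. [folklore] -/
theorem GM_congr {L : ℕ} (hL : 1 ≤ L) {y : (Fin d × Fin d) × Site d} (hy : y.1.1 ≠ y.1.2)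
    (h : AgreeOn ((L : ℤ) • y.2) (deltaHi L ((L : ℤ) • y.2) y.1.1 y.1.2) V V') {x' : Site d}
    (hx' : PlaqIn ((L : ℤ) • y.2) (deltaHi L ((L : ℤ) • y.2) y.1.1 y.1.2) (x', y.1.1, y.1.2)) :
    GM L V y x' = GM L V' y x' := by
  have hc := inBox_farCorner' hL ((L : ℤ) • y.2) hy
  have hz := inBox_corner hL ((L : ℤ) • y.2) y.1.1 y.1.2
  unfold GM
  rw [axialFn_congr h hc hz, axialFn_congr h hc hx'.1, phiM_congr h hx']

/-- `ψ_U(y)` is determined by the bonds of the window box `Δ(p′_y)` (`cplaq_bavg_congr`). [folklore] -/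
theorem psiU_congr {L : ℕ} (hL : 1 ≤ L) {y : (Fin d × Fin d) × Site d} (hy : y.1.1 ≠ y.1.2)
    (h : AgreeOn ((L : ℤ) • y.2) (deltaHi L ((L : ℤ) • y.2) y.1.1 y.1.2) V V') :
    psiU L V y = psiU L V' y := by
  unfold psiU; rw [cplaq_bavg_congr L hL _ hy h]

/-- `Φ_U(y, x)` at a fine plaquette of NON-ZERO weight in the window of `y` is determined by the bonds of the window
box (the torus extension picks a window position, whose plaquette lies in the box). [folklore] -/
theorem PhiU_congr_of_tker {T L : ℕ} (hL : 1 ≤ L) {y : (Fin d × Fin d) × Site d} (hy : y.1.1 ≠ y.1.2)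
    (h : AgreeOn ((L : ℤ) • y.2) (deltaHi L ((L : ℤ) • y.2) y.1.1 y.1.2) V V') {x : Site d}
    (hx : tker T L y.1.1 y.1.2 y.2 x ≠ 0) : PhiU T L V y (y.1, x) = PhiU T L V' y (y.1, x) := by
  have hex := exists_slot_of_tker_ne_zero T L y.1.1 y.1.2 hx
  simp only [PhiU, if_true]
  unfold textend
  rw [dif_pos hex, dif_pos hex, GM_congr hL hy h (plaqIn_zpos hy _ (Classical.choose_spec hex).1)]

/-- The (bch) kernel sum `Σ_x pker(y, x) • Φ_U(y, x)` is determined by the bonds of the window box. [folklore] -/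
theorem bchSum_congr {T L : ℕ} (hL : 1 ≤ L) (planes : Finset (Fin d × Fin d)) {y : (Fin d × Fin d) × Site d}
    (hy : y.1.1 ≠ y.1.2) (h : AgreeOn ((L : ℤ) • y.2) (deltaHi L ((L : ℤ) • y.2) y.1.1 y.1.2) V V') :
    ∑ x ∈ pbox planes T, pker T L y x • PhiU T L V y x = ∑ x ∈ pbox planes T, pker T L y x • PhiU T L V' y x := by
  refine Finset.sum_congr rfl fun x _ => ?_
  by_cases hp : pker T L y x = 0
  · rw [hp, zero_smul, zero_smul]
  · unfold pker at hp ⊢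
    split_ifs at hp ⊢ with hyx
    · obtain ⟨P, x2⟩ := x
      simp only at hyx
      subst hyx
      rw [PhiU_congr_of_tker hL hy h hp]
    · exact absurd rfl hp

end Congr

/-! ## §4 The one-level binders of the `U(N)` chain under LOCAL hypotheses on the window box -/

section LocalBinders

variable {n : Type*} [Fintype n] [DecidableEq n]

/-- **(bch) at one window, `d = 4`, LOCAL HYPOTHESIS.**  `T4TermwiseChainUN.bch_PhiU_four` with (44) assumed ONLY for
the unit plaquettes `p ⊂ Δ(p′_y)` (the window box `[La, La + (L−1)𝟙 + Le_μ + Le_ν]`, B7 (46)):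
`‖ψ_U(y) − Σ_x pker(y, x) • Φ_U(y, x)‖ ≤ 280·(320·L²·α₀)²`.  Proof: the clamped extension `π^*V` of `V|Δ(p′_y)`
(`B7Prop1Local.clampCfg`) satisfies (44) everywhere with the same `α₀`, the global lemma applies to it, and both
sides of the (bch) expression are the same for `V` and `π^*V` (§3).  No gauge fixing; constants unchanged.
[folklore] -/
theorem bch_PhiU_local [Nonempty n] (T L : ℕ) (planes : Finset (Fin 4 × Fin 4)) (hplanes : ∀ P ∈ planes, P.1 ≠ P.2)
    {V : Site 4 → Fin 4 → (Matrix n n ℂ)ˣ} (hV : ∀ x κ, V x κ ∈ unitaryUnits (Matrix n n ℂ))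
    (hL : 1 ≤ L) (h2L : 2 * L ≤ T) {α₀ : ℝ} (hα₀ : 0 ≤ α₀) (hsmall : 20480 * (L : ℝ) ^ 2 * α₀ ≤ 1)
    (y : (Fin 4 × Fin 4) × Site 4) (hy : y.1 ∈ planes)
    (h44 : ∀ (x : Site 4) (κ κ' : Fin 4), κ ≠ κ' →
      PlaqIn ((L : ℤ) • y.2) (deltaHi L ((L : ℤ) • y.2) y.1.1 y.1.2) (x, κ, κ') →
      ‖((hol V x (plaqWord κ κ') : (Matrix n n ℂ)ˣ) : Matrix n n ℂ) - 1‖ ≤ α₀) :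
    ‖psiU L V y - ∑ x ∈ pbox planes T, pker T L y x • PhiU T L V y x‖ ≤ 280 * (320 * (L : ℝ) ^ 2 * α₀) ^ 2 := by
  have hμν : y.1.1 ≠ y.1.2 := hplanes _ hy
  have hlohi : ∀ i, ((L : ℤ) • y.2) i ≤ deltaHi L ((L : ℤ) • y.2) y.1.1 y.1.2 i :=
    fun i => ((inBox_corner hL ((L : ℤ) • y.2) y.1.1 y.1.2) i).1.trans ((inBox_corner hL _ y.1.1 y.1.2) i).2
  set V' := clampCfg ((L : ℤ) • y.2) (deltaHi L ((L : ℤ) • y.2) y.1.1 y.1.2) V with hV'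
  have hV'U : ∀ x κ, V' x κ ∈ unitaryUnits (Matrix n n ℂ) := clampCfg_mem hV
  have h44' : ∀ (x : Site 4) (κ κ' : Fin 4), κ ≠ κ' →
      ‖((hol V' x (plaqWord κ κ') : (Matrix n n ℂ)ˣ) : Matrix n n ℂ) - 1‖ ≤ α₀ :=
    fun x κ κ' hκκ' => norm_hol_plaqWord_clampCfg_le hlohi V hκκ' hα₀ (fun x hx => h44 x κ κ' hκκ' hx) x
  have hagree : AgreeOn ((L : ℤ) • y.2) (deltaHi L ((L : ℤ) • y.2) y.1.1 y.1.2) V V' := (clampCfg_agree V).symm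
  rw [psiU_congr hL hμν hagree, bchSum_congr hL planes hμν hagree]
  exact bch_PhiU_four T L planes hplanes hV'U hL h2L hα₀ hsmall h44' y hy

/-- **(sz) at one plaquette, LOCAL HYPOTHESIS:** `‖φ_U(x)‖ ≤ 2·|V(∂p_x) − 1|` as soon as `|V(∂p_x) − 1| ≤ ½` ((20),
(26)); in particular `≤ 2α₀` from (44) at THIS plaquette only. [folklore] -/
theorem norm_phiU_le_local {d : ℕ} {V : Site d → Fin d → (Matrix n n ℂ)ˣ} (x : (Fin d × Fin d) × Site d) {α₀ : ℝ}
    (hα₀ : α₀ ≤ 1 / 2)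
    (h44x : ‖((hol V x.2 (plaqWord x.1.1 x.1.2) : (Matrix n n ℂ)ˣ) : Matrix n n ℂ) - 1‖ ≤ α₀) :
    ‖phiU V x‖ ≤ 2 * α₀ :=
  (norm_piU_mlog_le (h44x.trans hα₀)).trans (by linarith)

/-- **(sz) window-wise, LOCAL HYPOTHESIS:** for a `T`-periodic configuration and a fine label `x` of NON-ZERO
weight in the window of `y`, `‖φ_U(x)‖ ≤ 2α₀` from (44) on the window box `Δ(p′_y)` alone — the plaquette of `x` is
congruent mod `T` to a window position, whose plaquette lies in the box. [folklore] -/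
theorem norm_phiU_le_window_local {d T L : ℕ} {V : Site d → Fin d → (Matrix n n ℂ)ˣ} (hper : IsPeriodic T V)
    (y x : (Fin d × Fin d) × Site d) (hy : y.1.1 ≠ y.1.2) {α₀ : ℝ} (hα₀ : α₀ ≤ 1 / 2)
    (h44 : ∀ z : Site d, PlaqIn ((L : ℤ) • y.2) (deltaHi L ((L : ℤ) • y.2) y.1.1 y.1.2) (z, y.1.1, y.1.2) →
      ‖((hol V z (plaqWord y.1.1 y.1.2) : (Matrix n n ℂ)ˣ) : Matrix n n ℂ) - 1‖ ≤ α₀)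
    (hx : 0 < pker T L y x) : ‖phiU V x‖ ≤ 2 * α₀ := by
  obtain ⟨P, x₂⟩ := x
  unfold pker at hx
  split_ifs at hx with h
  · simp only at h
    subst h
    obtain ⟨s, hs, hcls⟩ := exists_slot_of_tker_ne_zero T L y.1.1 y.1.2 hx.ne'
    have hhol : hol V x₂ (plaqWord y.1.1 y.1.2) = hol V (zpos L y.1.1 y.1.2 ((L : ℤ) • y.2) s) (plaqWord y.1.1 y.1.2) :=
      ((hper.hol (plaqWord y.1.1 y.1.2)).eq_of_tcls_eq hcls).symm
    unfold phiU phiM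
    simp only
    rw [hhol]
    exact norm_phiU_le_local (V := V) (y.1, zpos L y.1.1 y.1.2 ((L : ℤ) • y.2) s) hα₀ (h44 _ (plaqIn_zpos hy _ hs))
  · exact absurd hx (lt_irrefl 0)

/-- **(osc-U) at one window, LOCAL HYPOTHESIS.**  `T4TermwiseChainUN.norm_PhiU_sub_PhiU` with the one-bond covariant
oscillation bound `α₁` of the plaquette-log field assumed ONLY on the bonds of the window box `Δ(p′_y)`: two fine
labels in the support of the averaging kernel of `y` carry transported data at most `4dL·α₁` apart (telescoping along
the two tree contours from the far corner, which stay in the box — §1). [folklore] -/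
theorem norm_PhiU_sub_PhiU_local [Nonempty n] {d : ℕ} (T L : ℕ) (hL : 1 ≤ L)
    {V : Site d → Fin d → (Matrix n n ℂ)ˣ} (hV : ∀ x κ, V x κ ∈ unitaryUnits (Matrix n n ℂ)) {α₁ : ℝ} (hα₁ : 0 ≤ α₁)
    (y x x' : (Fin d × Fin d) × Site d) (hy : y.1.1 ≠ y.1.2)
    (hbond : ∀ (z : Site d) (κ : Fin d), InBox ((L : ℤ) • y.2) (deltaHi L ((L : ℤ) • y.2) y.1.1 y.1.2) z →
      InBox ((L : ℤ) • y.2) (deltaHi L ((L : ℤ) • y.2) y.1.1 y.1.2) (z + e κ) →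
      ‖((V z κ : (Matrix n n ℂ)ˣ) : Matrix n n ℂ) * phiM V y.1 (z + e κ)
          * (((V z κ)⁻¹ : (Matrix n n ℂ)ˣ) : Matrix n n ℂ) - phiM V y.1 z‖ ≤ α₁)
    (hx : 0 < pker T L y x) (hx' : 0 < pker T L y x') :
    ‖PhiU T L V y x - PhiU T L V y x'‖ ≤ 4 * (d : ℝ) * L * α₁ := by
  have hU : ∀ x κ, V x κ ∈ U1 (Matrix n n ℂ) := U1_of_U hV
  set c := farCorner L y with hc
  have hcbox : InBox ((L : ℤ) • y.2) (deltaHi L ((L : ℤ) • y.2) y.1.1 y.1.2) c := inBox_farCorner' hL _ hy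
  -- telescoping from the far corner to a window position, inside the box
  have hW : ∀ s ∈ slots L,
      ‖((axialFn V c (zpos L y.1.1 y.1.2 ((L : ℤ) • y.2) s) : (Matrix n n ℂ)ˣ) : Matrix n n ℂ)
          * phiM V y.1 (zpos L y.1.1 y.1.2 ((L : ℤ) • y.2) s)
          * (((axialFn V c (zpos L y.1.1 y.1.2 ((L : ℤ) • y.2) s))⁻¹ : (Matrix n n ℂ)ˣ) : Matrix n n ℂ)
        - phiM V y.1 c‖ ≤ 2 * (d : ℝ) * L * α₁ := fun s hs => by
    have hq := (plaqIn_zpos hy ((L : ℤ) • y.2) hs).1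
    have h := conjOsc_treeWord hU hbond c (zpos L y.1.1 y.1.2 ((L : ℤ) • y.2) s - c) hcbox
      (by rw [add_sub_cancel]; exact hq)
    rw [add_sub_cancel] at h
    refine (le_of_eq_of_le (by rfl) h).trans ?_
    exact mul_le_mul_of_nonneg_right (by rw [hc]; exact l1_zpos_sub_farCorner_le hy y.2 hs) hα₁
  have key : ∀ {x : (Fin d × Fin d) × Site d}, 0 < pker T L y x →
      ∃ s ∈ slots L, PhiU T L V y x = piU (GM L V y (zpos L y.1.1 y.1.2 ((L : ℤ) • y.2) s)) := by
    intro x hx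
    unfold pker at hx
    split_ifs at hx with h
    · obtain ⟨s, hs, -, hG⟩ := textend_of_tker_ne_zero T L y.1.1 y.1.2 (GM L V y) (phiM V y.1) hx.ne'
      refine ⟨s, hs, ?_⟩
      rw [PhiU, if_pos h.symm, hG]
    · exact absurd hx (lt_irrefl 0)
  obtain ⟨s, hs, hPx⟩ := key hx
  obtain ⟨s', hs', hPx'⟩ := key hx'
  rw [hPx, hPx']
  calc _ ≤ ‖GM L V y (zpos L y.1.1 y.1.2 ((L : ℤ) • y.2) s) - GM L V y (zpos L y.1.1 y.1.2 ((L : ℤ) • y.2) s')‖ :=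
        norm_piU_sub_le _ _
    _ ≤ 2 * (d : ℝ) * L * α₁ + 2 * (d : ℝ) * L * α₁ := by
        rw [GM_eq_conj_U, GM_eq_conj_U, ← hc, norm_conj_sub_conj ((U1 (Matrix n n ℂ)).inv_mem (axialFn_mem hU _ _))]
        calc _ = ‖(((axialFn V c (zpos L y.1.1 y.1.2 ((L : ℤ) • y.2) s) : (Matrix n n ℂ)ˣ) : Matrix n n ℂ)
                  * phiM V y.1 (zpos L y.1.1 y.1.2 ((L : ℤ) • y.2) s)
                  * (((axialFn V c (zpos L y.1.1 y.1.2 ((L : ℤ) • y.2) s))⁻¹ : (Matrix n n ℂ)ˣ) : Matrix n n ℂ)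
                  - phiM V y.1 c)
                + (phiM V y.1 c - ((axialFn V c (zpos L y.1.1 y.1.2 ((L : ℤ) • y.2) s') : (Matrix n n ℂ)ˣ) : Matrix n n ℂ)
                  * phiM V y.1 (zpos L y.1.1 y.1.2 ((L : ℤ) • y.2) s')
                  * (((axialFn V c (zpos L y.1.1 y.1.2 ((L : ℤ) • y.2) s'))⁻¹ : (Matrix n n ℂ)ˣ) : Matrix n n ℂ))‖ := by
              rw [sub_add_sub_cancel]
          _ ≤ _ := norm_add_le _ _
          _ ≤ _ := add_le_add (hW s hs) (by rw [norm_sub_rev]; exact hW s' hs')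
    _ = 4 * (d : ℝ) * L * α₁ := by ring

end LocalBinders

end Summit.QuantumFields.BalabanUV.T4Continuum.TermwiseLocal
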